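import Summits.Ventures.HodgeKum4.Statement
import Summits.HodgeConjecture.HodgeConjecture.Theorems.Ring2AbelianAllAndreCorrespondenceCategory
import Summits.HodgeConjecture.CorCM.Stage4StrictRoadDischargePowers
import Literature.AlgebraicGeometry.HodgeTheory.MotivatedClassesAlgebraic
import Literature.AlgebraicGeometry.HodgeTheory.LefschetzStandardUnconditionalDegrees
import Literature.AlgebraicGeometry.HodgeTheory.ComplexGysin
import Literature.AlgebraicTopology.SingularHomology.CupProduct
import HarnessLib

/-!
# The two non-item inputs of the DOMINATION assembly of H3 are theorems of the tree
(cell `hodge-kum4`, seat p2; route `KummerFixedLocus`, `Summits/Ventures/HodgeKum4/Statement.lean` §6)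

HONEST FRAMING.  Nothing here proves a case of the Hodge conjecture.  The index module of the venture
carries, besides the official assembly `hc_kum4Type_of_inputs : L1 → L2 → F_Γ → F_Γ′ → L3° → H3`, the
alternative DOMINATION assembly
`hc_kum4Type_of_dominated : Arapura2006 fact → L1 → L2a′ → F_Γ → F_Γ′ → L3° → AlgebraicClassesDominated → H3 ∧ HC_Kum4TypePowers`.
This file records that its two non-item hypotheses are ALREADY THEOREMS of the tree:

* `algebraicClassesDominated_holds : AlgebraicClassesDominated` — PROVED here (folklore bookkeeping:
  an algebraic class `z ∈ Nᵖ H²ᵖ(Y(ℂ))` is the image of `1 ∈ H⁰(B⁰(ℂ))`, `B⁰ = Spec ℂ`, under the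
  algebraic correspondence `(· ∪ z) ∘ t^*`, `t : Y → Spec ℂ`; ingredients: pull-backs are algebraic
  correspondences (`isAlgebraicCorrespondence_map`, André 1996 §2.1), cup product with an algebraic
  class is one (`isAlgebraicCorrespondence_flip_cupProduct_of_mem_algebraicClasses`, Voisin II (10.7)),
  composites are (`IsAlgebraicCorrespondence.comp`, ring 2, Fulton 16.1.1), `t^* 1 = 1`, `1 ∪ z = z`);
* Arapura 2006 Lemma 4.2 (`HodgeTheory.Arapura2006_hodgeClasses_algebraic_of_isDominatedByPowers`) is
  DISCHARGED in the tree by `Summit.HodgeConjecture.CorCM.Stage4.Arapura2006_hodgeClasses_algebraic_of_isDominatedByPowers_holds`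
  (Stage 4 of the HodgeConjecture summit) — re-exported below as `hc_kum4Type_of_dominated'` with that
  hypothesis fed, so that the domination road reads `L1 → L2a′ → F_Γ → F_Γ′ → L3° → H3 ∧ HC for all powers`
  with NO named fact and NO kernel target left outside the five route nodes (L2a′ ⇐ L2a by
  `gammaInvariantsDominated_of_retract`; L2c is not needed on this road).
-/

noncomputable section

open CategoryTheory MonoidalCategory CartesianMonoidalCategory
open Literature.AlgebraicGeometry Literature.AlgebraicGeometry.Motives Literature.AlgebraicGeometry.HodgeTheory
open Literature.AlgebraicTopology.SingularHomology
open Summit.HodgeConjecture.HodgeConjecture.Ring2.AbelianAll (IsAlgebraicCorrespondence.comp)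

namespace Summit.Ventures.HodgeKum4

/-- **Algebraic classes are dominated** (the bookkeeping input of the domination assembly, PROVED): every
`z ∈ Nᵖ H²ᵖ(Y(ℂ); ℂ)` lies in the image of an algebraic correspondence from `B⁰ = Spec ℂ`, namely
`(· ∪ z) ∘ t^*` applied to `1 ∈ H⁰`, `t : Y ⟶ Spec ℂ`. -/
theorem algebraicClassesDominated_holds : Summit.Ventures.HodgeKum4.AlgebraicClassesDominated := by
  intro dY Y dX B hY hB p z hz
  by_cases hp : 2 * p ≤ 2 * dY
  · have h0 : IsSmoothProjective (0 * dX) (B.pow 0) := hB.pow 0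
    let t : Y ⟶ B.pow 0 := toUnit Y
    have hT' : IsAlgebraicCorrespondence dY (0 * dX) Y (B.pow 0) (complexBetti.map t 0).hom :=
      isAlgebraicCorrespondence_map hY h0 t (Nat.zero_le _)
    have hT : IsAlgebraicCorrespondence dY dY Y Y ((cupProduct (Nat.zero_add (2 * p))).flip z) :=
      isAlgebraicCorrespondence_flip_cupProduct_of_mem_algebraicClasses hY (Nat.zero_add _) hp hz
    have hTT : IsAlgebraicCorrespondence dY (0 * dX) Y (B.pow 0)
        ((cupProduct (Nat.zero_add (2 * p))).flip z ∘ₗ (complexBetti.map t 0).hom) :=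
      IsAlgebraicCorrespondence.comp hY hY h0 hT' hT (Nat.zero_le _)
    refine Submodule.subset_span ⟨0, 0, _, hTT, ?_⟩
    refine ⟨singularCohomology.one ℂ (Motives.ComplexPoints (B.pow 0)), ?_⟩
    rw [LinearMap.comp_apply, LinearMap.flip_apply]
    have h1 : (complexBetti.map t 0).hom (singularCohomology.one ℂ (Motives.ComplexPoints (B.pow 0))) =
        singularCohomology.one ℂ (Motives.ComplexPoints Y) :=
      singularCohomology.map_one (Motives.AlgPoints.mapContinuous (L := ℂ) t)
    rw [h1]
    exact one_cupProduct z
  · haveI := subsingleton_complexBetti hY (k := 2 * p) (by omega)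
    rw [Subsingleton.elim z 0]
    exact Submodule.zero_mem _

/-- **The domination road, record-free**: `L1 → L2a′ → F_Γ → F_Γ′ → L3° → (H3 ∧ HC for all powers
of every smooth projective Kum⁴-type X)` — `hc_kum4Type_of_dominated` with Arapura's Lemma 4.2 fed by
its tree discharge (`CorCM.Stage4`) and the bookkeeping input fed by `algebraicClassesDominated_holds`. -/
theorem hc_kum4Type_of_dominated' (h₁ : LefschetzGenerationKum4) (h₂ : GammaInvariantsDominatedKum4)
    (hΓ : Kum4TranslationGroup) (hoff : Kum4TranslationGroupTrivialOffMiddle)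
    (h₃ : Kum4NonInvariantClassesAlgebraic) :
    Summit.Ventures.HodgeKum4.HC_Kum4Type ∧ Summit.Ventures.HodgeKum4.HC_Kum4TypePowers :=
  hc_kum4Type_of_dominated
    Summit.HodgeConjecture.CorCM.Stage4.Arapura2006_hodgeClasses_algebraic_of_isDominatedByPowers_holds
    h₁ h₂ hΓ hoff h₃ algebraicClassesDominated_holds

/-- The same from the RETRACT form L2a (the route's split child of L2) instead of L2a′. -/
theorem hc_kum4Type_of_retract (h₁ : LefschetzGenerationKum4) (h₂ : GammaInvariantsRetractKum4)
    (hΓ : Kum4TranslationGroup) (hoff : Kum4TranslationGroupTrivialOffMiddle)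
    (h₃ : Kum4NonInvariantClassesAlgebraic) :
    Summit.Ventures.HodgeKum4.HC_Kum4Type ∧ Summit.Ventures.HodgeKum4.HC_Kum4TypePowers :=
  hc_kum4Type_of_dominated' h₁ (gammaInvariantsDominated_of_retract h₂) hΓ hoff h₃

/-- **L2 from L2a′ (dominated form) on the domination road**: given F_Γ, F_Γ′ and L3°, the span-form
datum `GammaInvariantsDominatedKum4` (weaker than the retract form L2a: no projectors `vᵢ ∘ uᵢ`) already
yields L2 — a candidate glue for a split of `MotivicBookkeepingKum4` into
{L2a′, F_Γ (shared), F_Γ′ (shared), L3° (shared)}. -/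
theorem motivicBookkeepingKum4_of_dominated_of_fixedLocus (h₂ : GammaInvariantsDominatedKum4)
    (hΓ : Kum4TranslationGroup) (hoff : Kum4TranslationGroupTrivialOffMiddle)
    (h₃ : Kum4NonInvariantClassesAlgebraic) : Summit.Ventures.HodgeKum4.MotivicBookkeepingKum4 := by
  intro h₁ X hX hK p c hrat hpp _
  have hHC : HC_Kum4Type := (hc_kum4Type_of_dominated' h₁ h₂ hΓ hoff h₃).1
  exact (hodgeConjectureFor_iff.1 (hHC hX hK)).2 p c hrat hpp

/-- **L2 from L2a on the domination road** (a candidate glue for the planner's split of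
`MotivicBookkeepingKum4` that bypasses the kernel target L2c): given F_Γ, F_Γ′ and L3°, the retract
datum L2a already yields L2 — indeed HC for `X`, whence every rational `(p,p)`-class, invariant or
not, is algebraic. -/
theorem motivicBookkeepingKum4_of_retract_of_fixedLocus (h₂ : GammaInvariantsRetractKum4)
    (hΓ : Kum4TranslationGroup) (hoff : Kum4TranslationGroupTrivialOffMiddle)
    (h₃ : Kum4NonInvariantClassesAlgebraic) : Summit.Ventures.HodgeKum4.MotivicBookkeepingKum4 := by
  intro h₁ X hX hK p c hrat hpp _
  have hHC : HC_Kum4Type := (hc_kum4Type_of_retract h₁ h₂ hΓ hoff h₃).1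
  exact (hodgeConjectureFor_iff.1 (hHC hX hK)).2 p c hrat hpp

end Summit.Ventures.HodgeKum4

end
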